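import Summits.ResolutionOfSingularities.ResolutionOfSingularities.Theorems.HilbertSamuelEliminationCampaignW42NearChainCorridor3
import Summits.ResolutionOfSingularities.ResolutionOfSingularities.Theorems.HilbertSamuelEliminationCampaignW42NearChainAssembly
import Summits.ResolutionOfSingularities.ResolutionOfSingularities.Theorems.HilbertSamuelEliminationModificationsResolve
import HarnessLib

/-!
# [OURS · L1 W4.2] THE SUMMIT MODULO THE TYPED O2-TYPE ITEM: `(∀ p prime, NearChainTermination p)` implies
# `SigmaMaxModifications` (crux stmt-ResolutionOfSingularities-18506) and `ResolutionOfSingularities` — by induction on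
# dimension inside CJS's own architecture, with NO printed input left (`--supports stmt-ResolutionOfSingularities-17846`)

OURS (slot W4.2 of cell res-hironaka, LADDER-RESOLUTION rung L, D-0089; prover seat res-L1-s42-pv-2, gen 2); NOT
statements of H. Hironaka's manuscript [Hironaka2017]; nothing of the manuscript is used or asserted. AI review is
weaker than expert review. Pure PROOF file; no new definition. CONDITIONAL THEOREMS — they credit nothing: their one
hypothesis is the OURS open item `NearChainTermination p` (`…CampaignW42NearChain.lean`, p487178; OPEN from dimension
three = obstruction O2 of CJS in its sharpest typed form).

THE INDUCTION ON DIMENSION (CJS Rem. 6.29 (1): «By induction on dimension we have a canonical resolution sequence …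
for `(Y_0, 𝓑_{Y_0})`»), over a field `k` of characteristic `p`, in the class 𝒞 = «separated, of finite type over `k`,
reduced»:
* `answers_of_dim_le_zero`, `answers_of_resolutions` — the oracle's questions along `S(X, ν)` (reduced closed non-empty
  subsets of `ν`-strata of the stages, `ν ≠ Φ^{(N)}`) concern members of 𝒞 of dimension `< dim X` (dimension drop,
  `topologicalKrullDim_lt_of_subset_hsStratum`); so resolution sequences with permissible centres in dimension `≤ e`
  answer them in dimension `≤ e + 1`, and in dimension `≤ 0` there are no questions.
* `resolutions_of_nearChainTermination` — for every `d`: every member of 𝒞 of dimension `≤ d` has a resolution sequence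
  with permissible centres over its non-regular locus and regular last stage. Step: the answers (induction hypothesis)
  + `NearChainTermination p` make every `S(Y, ν)` a `ν`-elimination with permissible centres (GeneralStrata file);
  sequential gluing and the Hilbert–Samuel tower (Assembly file, CJS Def. 6.14/6.15, Cor. 6.18, Thm. 6.17) give the
  resolution sequences in dimension `≤ d`.
* `nuMod_all_of_nearChainTermination`, `hsBody_of_nearChainTermination` — hence `ν`-modifications and the crux body
  `B(X, N)` for every non-regular member of 𝒞, every `N ≥ dim X` (graded glue `TameWild.hsBody_of_nuMods'`).
* `sigmaMaxModifications_of_nearChainTermination` — `(∀ p prime, NearChainTermination p) → SigmaMaxModifications`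
  (the route's parent crux, stmt-…-18506, by name).
* `resolutionOfSingularities_of_nearChainTermination` — `(∀ p prime, NearChainTermination p) → ResolutionOfSingularities`
  (the summit statement, through the route's proved bridge `ModificationsResolve_proof`).

READING. In the tree's rendering of the Cossart–Jannsen–Saito strategy, resolution of singularities in positive
characteristic (all dimensions) is REDUCED, kernel-checked, to ONE statement: along the canonical sequence `S(X, ν)`
no closed point of a maximal Hilbert–Samuel stratum starts an infinite chain of closed near points — the typed form of
«the lack of … suitable tertiary invariants» (CJS §1.3). Nothing is claimed about that statement.

## References

* V. Cossart, U. Jannsen, S. Saito, LNM 2270 (2020), §1.3, Rem. 6.29 (1), Def. 6.14/6.15, Cor. 6.18, Thm. 6.17, p. 107.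
  [CossartJannsenSaito2020]
* route file Theses/HilbertSamuelElimination.lean (stmt-…-18506, `ModificationsResolve`); Statement.lean.
-/

noncomputable section

set_option linter.dupNamespace false -- mandated namespace of this single-conjunct summit

open CategoryTheory AlgebraicGeometry TopologicalSpace Topology IsLocalRing

namespace Summit.ResolutionOfSingularities.ResolutionOfSingularities.Theorems

namespace CampaignW42

open Literature.AlgebraicGeometry.Resolution Literature.RingTheory.HilbertSamuel
open Summit.ResolutionOfSingularities.ResolutionOfSingularities.Theses.HilbertSamuelElimination
open Summit.ResolutionOfSingularities.ResolutionOfSingularities.Theorems.SigmaMaxModificationsCorridor3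

/-! ## Dimension drop and the oracle's questions -/

/-- **Closed subsets of a `ν`-stratum (`ν ≠ Φ^{(N)}`, `dim ≤ N`) of a reduced Noetherian stage of dimension `≤ d` have
dimension `< d`** (non-regular locus, dense regular locus, dimension drop). [cite: CossartJannsenSaito2020, Lemma 2.31] -/
theorem topologicalKrullDim_lt_of_subset_hsStratum {W : Scheme.{0}} [IsNoetherian W] [IsReduced W] {N : ℕ}
    {ν : ℕ → ℕ} (hν : ν ≠ iterPSum N Phi) (hdimN : topologicalKrullDim W ≤ (N : WithBot ℕ∞)) {d : ℕ}
    (hdimd : topologicalKrullDim W ≤ (d : WithBot ℕ∞)) {Z : Set W} (hZc : IsClosed Z)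
    (hZ : Z ⊆ Scheme.hsStratum W N ν) : topologicalKrullDim Z < (d : WithBot ℕ∞) := by
  have hsing := subset_compl_regularLocus_of_subset_hsStratum hν hdimN hZ
  have hdense : Dense Zᶜ := (Scheme.dense_regularLocus W).mono (Set.subset_compl_comm.mp hsing)
  have hlt : topologicalKrullDim W < ((d + 1 : ℕ) : WithBot ℕ∞) :=
    lt_of_le_of_lt hdimd (by exact_mod_cast Nat.lt_succ_self d)
  exact topologicalKrullDim_lt_of_isClosed_of_dense_compl hZc hdense d hlt

variable {k : Type} [Field k] {R : ∀ S : Scheme.{0}, CentreSeq S → Prop}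

/-- **In dimension `≤ 0` the oracle is asked nothing** along `S(X, ν)` (`ν ≠ Φ^{(N)}`): a closed non-empty subset of a
`ν`-stratum of a stage would have negative dimension. [folklore] -/
theorem answers_of_dim_le_zero {X : Scheme.{0}} (f : X ⟶ Spec (.of k)) [IsSeparated f] [LocallyOfFiniteType f]
    [QuasiCompact f] [IsReduced X] {N : ℕ} (hdimN : topologicalKrullDim X ≤ (N : WithBot ℕ∞)) {ν : ℕ → ℕ}
    (hν : ν ≠ iterPSum N Phi) (hdim0 : topologicalKrullDim X ≤ ((0 : ℕ) : WithBot ℕ∞)) (s : CentreSeq X)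
    (Z : Set s.top) (hZ : IsClosed Z) (hZν : Z ⊆ Scheme.hsStratum s.top N ν) (hne : Z.Nonempty) :
    ∃ t, R (Scheme.IdealSheafData.vanishingIdeal ⟨Z, hZ⟩).subscheme t := by
  haveI : IsLocallyNoetherian X := LocallyOfFiniteType.isLocallyNoetherian f
  haveI : IsProper s.comp := CentreSeq.isProper_comp s
  haveI : IsNoetherian s.top := Scheme.isNoetherian_of_finiteType_over_field (s.comp ≫ f)
  haveI : IsReduced s.top := SigmaMaxModifications.Sketch.isReduced_top s
  have hlt := topologicalKrullDim_lt_of_subset_hsStratum hν (CentreSeq.topologicalKrullDim_top_le s hdimN)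
    (CentreSeq.topologicalKrullDim_top_le s hdim0) hZ hZν
  have hempty : Z = ∅ := Literature.Topology.eq_empty_of_topologicalKrullDim_lt_zero hZ (by exact_mod_cast hlt)
  exact absurd hempty hne.ne_empty

/-- **Resolution sequences with permissible centres in dimension `≤ e` answer the oracle's questions in dimension
`≤ e + 1`** (the reduced closed non-empty subsets of the `ν`-strata of the stages are members of the class of
dimension `≤ e`; an oracle answering on resolvable schemes answers). [cite: CossartJannsenSaito2020, Rem. 6.29 (1)] -/
theorem answers_of_resolutions
    (hRtot : ∀ S : Scheme.{0}, (∃ t : CentreSeq S, t.AllPermissible ∧ t.CentresOver (Scheme.regularLocus S)ᶜ ∧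
      Literature.AlgebraicGeometry.Resolution.Scheme.IsRegular t.top) → ∃ t, R S t)
    {e : ℕ} (hres : ∀ (T : Scheme.{0}) (h : T ⟶ Spec (.of k)) [IsSeparated h] [LocallyOfFiniteType h]
      [QuasiCompact h] [IsReduced T], topologicalKrullDim T ≤ (e : WithBot ℕ∞) →
      ∃ t : CentreSeq T, t.AllPermissible ∧ t.CentresOver (Scheme.regularLocus T)ᶜ ∧
        Literature.AlgebraicGeometry.Resolution.Scheme.IsRegular t.top)
    {X : Scheme.{0}} (f : X ⟶ Spec (.of k)) [IsSeparated f] [LocallyOfFiniteType f] [QuasiCompact f]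
    [IsReduced X] {N : ℕ} (hdimN : topologicalKrullDim X ≤ (N : WithBot ℕ∞)) {ν : ℕ → ℕ}
    (hν : ν ≠ iterPSum N Phi) (hdim : topologicalKrullDim X ≤ ((e + 1 : ℕ) : WithBot ℕ∞)) (s : CentreSeq X)
    (Z : Set s.top) (hZ : IsClosed Z) (hZν : Z ⊆ Scheme.hsStratum s.top N ν) (_hne : Z.Nonempty) :
    ∃ t, R (Scheme.IdealSheafData.vanishingIdeal ⟨Z, hZ⟩).subscheme t := by
  haveI : IsLocallyNoetherian X := LocallyOfFiniteType.isLocallyNoetherian f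
  haveI : IsProper s.comp := CentreSeq.isProper_comp s
  haveI : IsNoetherian s.top := Scheme.isNoetherian_of_finiteType_over_field (s.comp ≫ f)
  haveI : IsReduced s.top := SigmaMaxModifications.Sketch.isReduced_top s
  set T := (Scheme.IdealSheafData.vanishingIdeal ⟨Z, hZ⟩ : s.top.IdealSheafData) with hT
  haveI : IsReduced T.subscheme := ComponentGluing.isReduced_subscheme_vanishingIdeal ⟨Z, hZ⟩
  have hdimT : topologicalKrullDim T.subscheme ≤ (e : WithBot ℕ∞) := by
    rw [hT, topologicalKrullDim_subscheme_vanishingIdeal]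
    exact withBotENat_le_of_lt_succ (topologicalKrullDim_lt_of_subset_hsStratum hν
      (CentreSeq.topologicalKrullDim_top_le s hdimN) (CentreSeq.topologicalKrullDim_top_le s hdim) hZ hZν)
  obtain ⟨t, hperm, hover, hreg⟩ := hres T.subscheme (T.subschemeι ≫ s.comp ≫ f) hdimT
  exact hRtot _ ⟨t, hperm, hover, hreg⟩

/-! ## The induction on dimension -/

/-- **RESOLUTION SEQUENCES IN EVERY DIMENSION FROM `NearChainTermination p`.** For a field `k` of characteristic `p`
and a functional admissible oracle answering on resolvable schemes: every separated reduced `T` of finite type over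
`k` with `dim T ≤ d` carries a blow-up sequence with PERMISSIBLE centres over `T ∖ Reg T` and REGULAR last stage —
by induction on `d` (answers from dimension `< d`; `S(Y, ν)` is a `ν`-elimination for every maximal `ν` by
`NearChainTermination p`; gluing and the Hilbert–Samuel tower). [cite: CossartJannsenSaito2020, Rem. 6.29 (1), Cor. 6.18, Thm. 6.17] -/
theorem resolutions_of_nearChainTermination {p : ℕ} (h : NearChainTermination.{0} p) [CharP k p]
    (hRf : OracleFunctional R) (hRa : OracleAdmissible R)
    (hRtot : ∀ S : Scheme.{0}, (∃ t : CentreSeq S, t.AllPermissible ∧ t.CentresOver (Scheme.regularLocus S)ᶜ ∧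
      Literature.AlgebraicGeometry.Resolution.Scheme.IsRegular t.top) → ∃ t, R S t) (d : ℕ) :
    ∀ (T : Scheme.{0}) (g : T ⟶ Spec (.of k)) [IsSeparated g] [LocallyOfFiniteType g] [QuasiCompact g]
      [IsReduced T], topologicalKrullDim T ≤ (d : WithBot ℕ∞) →
      ∃ t : CentreSeq T, t.AllPermissible ∧ t.CentresOver (Scheme.regularLocus T)ᶜ ∧
        Literature.AlgebraicGeometry.Resolution.Scheme.IsRegular t.top := by
  induction d with
  | zero =>
    intro T g _ _ _ _ hdim
    refine exists_resolutionSeq_overField (k := k) (d := 0) (fun Y g' _ _ _ _ hdimY ν hmax hν => ?_) T g hdim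
    haveI : IsLocallyNoetherian Y := LocallyOfFiniteType.isLocallyNoetherian g'
    obtain ⟨s, -, hs⟩ := exists_isNuElimination_of_forall_noNearChain hRf hRa g' hdimY hmax hν
      (fun s _ Z hZ hZν hne => answers_of_dim_le_zero g' hdimY hν hdimY s Z hZ hZν hne)
      (fun y hy hycl => h R hRf hRa 0 ν Y y ⟨⟨k, ‹_›, ‹_›, g', ‹_›, ‹_›, ‹_›⟩, ‹_›, hdimY, hmax, hycl, hy⟩)
    exact ⟨s, hs.1, SigmaMaxModifications.Sketch.nuEliminationData_of_isNuElimination CossartJannsenSaito2020_thm_3_10_1_holds g'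
      hdimY hmax s hs⟩
  | succ e ih =>
    intro T g _ _ _ _ hdim
    refine exists_resolutionSeq_overField (k := k) (d := e + 1) (fun Y g' _ _ _ _ hdimY ν hmax hν => ?_) T g hdim
    haveI : IsLocallyNoetherian Y := LocallyOfFiniteType.isLocallyNoetherian g'
    obtain ⟨s, -, hs⟩ := exists_isNuElimination_of_forall_noNearChain hRf hRa g' hdimY hmax hν
      (fun s _ Z hZ hZν hne => answers_of_resolutions hRtot ih g' hdimY hν hdimY s Z hZ hZν hne)
      (fun y hy hycl => h R hRf hRa (e + 1) ν Y y ⟨⟨k, ‹_›, ‹_›, g', ‹_›, ‹_›, ‹_›⟩, ‹_›, hdimY, hmax, hycl, hy⟩)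
    exact ⟨s, hs.1, SigmaMaxModifications.Sketch.nuEliminationData_of_isNuElimination CossartJannsenSaito2020_thm_3_10_1_holds g'
      hdimY hmax s hs⟩

/-! ## `ν`-modifications, the crux body, the crux, the summit -/

/-- **`ν`-MODIFICATION OF EVERY MAXIMAL STRATUM, EVERY DIMENSION, from `NearChainTermination p`**: `X` separated reduced
of finite type over a field of characteristic `p`, `dim X ≤ N`, `dim X ≤ d`, `ν ≠ Φ^{(N)}` maximal ⇒
`TameWild.NuMod X N d ν` (the choice oracle; its answers from `resolutions_of_nearChainTermination`).
[cite: CossartJannsenSaito2020, Def. 6.14, Rem. 6.29 (1)] -/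
theorem nuMod_all_of_nearChainTermination {p : ℕ} (h : NearChainTermination.{0} p) [CharP k p] {X : Scheme.{0}}
    [IsLocallyNoetherian X] (f : X ⟶ Spec (.of k)) [IsSeparated f] [LocallyOfFiniteType f] [QuasiCompact f]
    [IsReduced X] {N : ℕ} (hdimN : topologicalKrullDim X ≤ (N : WithBot ℕ∞)) {d : ℕ}
    (hdimd : topologicalKrullDim X ≤ (d : WithBot ℕ∞)) {ν : ℕ → ℕ} (hmax : Maximal (· ∈ Scheme.hsValues X N) ν)
    (hν : ν ≠ iterPSum N Phi) : TameWild.NuMod X N d ν := by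
  obtain ⟨R, hRf, hRa, hRtot⟩ := exists_choiceOracle.{0}
  have hdimN' : topologicalKrullDim X ≤ ((N + 1 : ℕ) : WithBot ℕ∞) :=
    hdimN.trans (by exact_mod_cast Nat.le_succ N)
  exact nuMod_of_nearChainTermination h hRf hRa f hdimN hdimd hmax hν fun s _ Z hZ hZν hne =>
    answers_of_resolutions hRtot (resolutions_of_nearChainTermination h hRf hRa hRtot N) f hdimN hν hdimN' s Z hZ
      hZν hne

/-- **THE CRUX BODY `B(X, N)` from `NearChainTermination p`**: every non-regular separated reduced `X` of finite type over
a field of characteristic `p` with `dim X ≤ N` has a `Σ^max`-modification at level `N` (CJS Def. 6.15; graded glue).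
[cite: CossartJannsenSaito2020, Def. 6.15, Rem. 6.24] -/
theorem hsBody_of_nearChainTermination {p : ℕ} (h : NearChainTermination.{0} p) (k : Type) [Field k] [CharP k p]
    (N : ℕ) (X : Scheme.{0}) (f : X ⟶ Spec (.of k)) (hsep : IsSeparated f) (hft : LocallyOfFiniteType f)
    (hqc : QuasiCompact f) (hred : IsReduced X) (hreg : ¬ Scheme.IsRegular X)
    (hdN : topologicalKrullDim X ≤ (N : WithBot ℕ∞)) : TameWild.HSBody X N := by
  refine TameWild.hsBody_of_nuMods' k N N (fun Y g hsep' hft' hqc' hred' hYN _ ν hν hνΦ => ?_) X f hsep hft hqc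
    hred hreg hdN hdN
  haveI := hsep'
  haveI := hft'
  haveI := hqc'
  haveI := hred'
  haveI : IsLocallyNoetherian Y := LocallyOfFiniteType.isLocallyNoetherian g
  exact nuMod_all_of_nearChainTermination h g hYN hYN hν hνΦ

/-- **THE ROUTE'S PARENT CRUX FROM THE TYPED O2-TYPE ITEM: `(∀ p prime, NearChainTermination p) → SigmaMaxModifications`**
(stmt-ResolutionOfSingularities-18506, by name; the decl's inline `H^N` / `X_max` / `Σ_X` are `Scheme.hsFun` /
`hsMaxLocus` / `hsValues` by `rfl`). Conditional; credits nothing. [cite: CossartJannsenSaito2020, Def. 6.15, Rem. 6.29 (1)] -/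
theorem sigmaMaxModifications_of_nearChainTermination (hB : ∀ p : ℕ, p.Prime → NearChainTermination.{0} p) :
    SigmaMaxModifications := by
  intro p hp k _ _ X f hsep hft hqc hred hreg N hdim
  exact hsBody_of_nearChainTermination (hB p hp) k N X f hsep hft hqc hred hreg hdim

/-- **THE SUMMIT STATEMENT FROM THE TYPED O2-TYPE ITEM: `(∀ p prime, NearChainTermination p) → ResolutionOfSingularities`**
— through the route's proved bridge `ModificationsResolve_proof` (CJS Cor. 6.18 with Thm. 6.17: `Σ^max`-modifications
resolve). Conditional; credits nothing; its hypothesis is OPEN (obstruction O2 of Cossart–Jannsen–Saito, typed).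
[cite: CossartJannsenSaito2020, §1.3, Cor. 6.18, Thm. 6.17, Rem. 6.29 (1)] -/
theorem resolutionOfSingularities_of_nearChainTermination (hB : ∀ p : ℕ, p.Prime → NearChainTermination.{0} p) :
    _root_.ResolutionOfSingularities :=
  fun p hp => ModificationsResolve_proof (sigmaMaxModifications_of_nearChainTermination hB) p hp

/-! ## The other two cruxes of the route by name (appended 2026-08-27, same seat) -/

/-- **`(∀ p prime, NearChainTermination p) → SigmaMaxModificationsDimGe4`** (stmt-ResolutionOfSingularities-19250, the
declared summit-hard residual «from dimension four», by name): a restriction of `SigmaMaxModifications`. Conditional;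
credits nothing. [cite: CossartJannsenSaito2020, Def. 6.15, Rem. 6.29 (1)] -/
theorem sigmaMaxModificationsDimGe4_of_nearChainTermination (hB : ∀ p : ℕ, p.Prime → NearChainTermination.{0} p) :
    SigmaMaxModificationsDimGe4 := by
  intro p hp k _ _ X f hsep hft hqc hred hreg _ N hdim
  exact hsBody_of_nearChainTermination (hB p hp) k N X f hsep hft hqc hred hreg hdim

/-- **`(∀ p prime, NearChainTermination p) → SigmaMaxModificationsLowDim`** (stmt-ResolutionOfSingularities-19251, «known
in print» piece, by name; here WITHOUT the printed facts `CossartJannsenSaito2020_sigmaMaxElimination` /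
`CossartPiltant2019General` it is landed conditionally on in the tree): a restriction of `SigmaMaxModifications`.
Conditional; credits nothing. [cite: CossartJannsenSaito2020, Def. 6.15, Rem. 6.29 (1)] -/
theorem sigmaMaxModificationsLowDim_of_nearChainTermination (hB : ∀ p : ℕ, p.Prime → NearChainTermination.{0} p) :
    SigmaMaxModificationsLowDim := by
  intro p hp k _ _ X f hsep hft hqc hred hreg N hdim _ _
  exact hsBody_of_nearChainTermination (hB p hp) k N X f hsep hft hqc hred hreg hdim

/-- **Every item of route HilbertSamuelElimination at once**: `(∀ p prime, NearChainTermination p)` gives the three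
dimension-graded cruxes and, through the route's own deciding composition (`closes` with the proved
`ModificationsResolve_proof`), the summit — the same term as `resolutionOfSingularities_of_nearChainTermination`, routed
through the route file's glue. Conditional; credits nothing. [cite: CossartJannsenSaito2020, Rem. 6.29 (1)] -/
theorem closes_of_nearChainTermination (hB : ∀ p : ℕ, p.Prime → NearChainTermination.{0} p) :
    _root_.ResolutionOfSingularities :=
  closes (sigmaMaxModificationsLowDim_of_nearChainTermination hB)
    (sigmaMaxModificationsCorridor3_of_noNearChains_route hB) (sigmaMaxModificationsDimGe4_of_nearChainTermination hB)
    ModificationsResolve_proof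
where
  /-- `Corridor3` from `NearChainTermination` WITHOUT the CJS surface fact (restriction of `SigmaMaxModifications`).
  [cite: CossartJannsenSaito2020, Def. 6.15, Rem. 6.29 (1)] -/
  sigmaMaxModificationsCorridor3_of_noNearChains_route (hB : ∀ p : ℕ, p.Prime → NearChainTermination.{0} p) :
      SigmaMaxModificationsCorridor3 := by
    intro p hp k _ _ X f hsep hft hqc hred hreg _ _ N hdim _ _
    exact hsBody_of_nearChainTermination (hB p hp) k N X f hsep hft hqc hred hreg hdim

/-! ## The ∃-oracle form at the summit level: only ANSWERING oracles matter (lane-B note (b), desk #39) -/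

/-- **Resolution sequences from the no-near-chain hypothesis FOR ONE ANSWERING ORACLE** (the oracle actually used: any
functional admissible `R` answering on resolvable schemes): same induction as `resolutions_of_nearChainTermination`, with
the hypothesis restricted to this `R`. [cite: CossartJannsenSaito2020, Rem. 6.29 (1), Cor. 6.18, Thm. 6.17] -/
theorem resolutions_of_noNearChains {p : ℕ} [CharP k p] (hRf : OracleFunctional R) (hRa : OracleAdmissible R)
    (hRtot : ∀ S : Scheme.{0}, (∃ t : CentreSeq S, t.AllPermissible ∧ t.CentresOver (Scheme.regularLocus S)ᶜ ∧
      Literature.AlgebraicGeometry.Resolution.Scheme.IsRegular t.top) → ∃ t, R S t)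
    (h : ∀ (N : ℕ) (ν : ℕ → ℕ) (X : Scheme.{0}) [IsLocallyNoetherian X] (x : X), IsMaximalOrigin p N ν X x →
      NoNearChainFrom R N ν (MarkedStage.init X x) fun _ => True) (d : ℕ) :
    ∀ (T : Scheme.{0}) (g : T ⟶ Spec (.of k)) [IsSeparated g] [LocallyOfFiniteType g] [QuasiCompact g]
      [IsReduced T], topologicalKrullDim T ≤ (d : WithBot ℕ∞) →
      ∃ t : CentreSeq T, t.AllPermissible ∧ t.CentresOver (Scheme.regularLocus T)ᶜ ∧
        Literature.AlgebraicGeometry.Resolution.Scheme.IsRegular t.top := by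
  induction d with
  | zero =>
    intro T g _ _ _ _ hdim
    refine exists_resolutionSeq_overField (k := k) (d := 0) (fun Y g' _ _ _ _ hdimY ν hmax hν => ?_) T g hdim
    haveI : IsLocallyNoetherian Y := LocallyOfFiniteType.isLocallyNoetherian g'
    obtain ⟨s, -, hs⟩ := exists_isNuElimination_of_forall_noNearChain hRf hRa g' hdimY hmax hν
      (fun s _ Z hZ hZν hne => answers_of_dim_le_zero g' hdimY hν hdimY s Z hZ hZν hne)
      (fun y hy hycl => h 0 ν Y y ⟨⟨k, ‹_›, ‹_›, g', ‹_›, ‹_›, ‹_›⟩, ‹_›, hdimY, hmax, hycl, hy⟩)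
    exact ⟨s, hs.1, SigmaMaxModifications.Sketch.nuEliminationData_of_isNuElimination
      CossartJannsenSaito2020_thm_3_10_1_holds g' hdimY hmax s hs⟩
  | succ e ih =>
    intro T g _ _ _ _ hdim
    refine exists_resolutionSeq_overField (k := k) (d := e + 1) (fun Y g' _ _ _ _ hdimY ν hmax hν => ?_) T g hdim
    haveI : IsLocallyNoetherian Y := LocallyOfFiniteType.isLocallyNoetherian g'
    obtain ⟨s, -, hs⟩ := exists_isNuElimination_of_forall_noNearChain hRf hRa g' hdimY hmax hν
      (fun s _ Z hZ hZν hne => answers_of_resolutions hRtot ih g' hdimY hν hdimY s Z hZ hZν hne)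
      (fun y hy hycl => h (e + 1) ν Y y ⟨⟨k, ‹_›, ‹_›, g', ‹_›, ‹_›, ‹_›⟩, ‹_›, hdimY, hmax, hycl, hy⟩)
    exact ⟨s, hs.1, SigmaMaxModifications.Sketch.nuEliminationData_of_isNuElimination
      CossartJannsenSaito2020_thm_3_10_1_holds g' hdimY hmax s hs⟩

/-- **THE SUMMIT FROM THE ∃-ORACLE-TYPE HYPOTHESIS**: if, for every prime `p` and every functional admissible oracle
WHICH ANSWERS ON RESOLVABLE SCHEMES, no closed point of a maximal stratum of a reduced separated finite-type scheme over
a field of characteristic `p` starts an infinite near chain along `S(X, ν)`, then `ResolutionOfSingularities`. Weaker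
hypothesis than `∀ p prime, NearChainTermination p` (oracles that get stuck are not constrained). Conditional; credits
nothing. [cite: CossartJannsenSaito2020, §1.3, Rem. 6.29 (1), Cor. 6.18, Thm. 6.17] -/
theorem resolutionOfSingularities_of_noNearChains_answering
    (hB : ∀ p : ℕ, p.Prime → ∀ R : ∀ S : Scheme.{0}, CentreSeq S → Prop, OracleFunctional R → OracleAdmissible R →
      (∀ S : Scheme.{0}, (∃ t : CentreSeq S, t.AllPermissible ∧ t.CentresOver (Scheme.regularLocus S)ᶜ ∧
        Literature.AlgebraicGeometry.Resolution.Scheme.IsRegular t.top) → ∃ t, R S t) →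
      ∀ (N : ℕ) (ν : ℕ → ℕ) (X : Scheme.{0}) [IsLocallyNoetherian X] (x : X), IsMaximalOrigin p N ν X x →
        NoNearChainFrom R N ν (MarkedStage.init X x) fun _ => True) :
    _root_.ResolutionOfSingularities := by
  intro p hp
  refine ModificationsResolve_proof ?_ p hp
  intro q hq k _ _ X f hsep hft hqc hred hreg N hdim
  obtain ⟨R, hRf, hRa, hRtot⟩ := exists_choiceOracle.{0}
  have hq' := hB q hq R hRf hRa hRtot
  refine TameWild.hsBody_of_nuMods' k N N (fun Y g hsep' hft' hqc' hred' hYN _ ν hν hνΦ => ?_) X f hsep hft hqc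
    hred hreg hdim hdim
  haveI := hsep'
  haveI := hft'
  haveI := hqc'
  haveI := hred'
  haveI : IsLocallyNoetherian Y := LocallyOfFiniteType.isLocallyNoetherian g
  have hYN' : topologicalKrullDim Y ≤ ((N + 1 : ℕ) : WithBot ℕ∞) := hYN.trans (by exact_mod_cast Nat.le_succ N)
  exact nuMod_of_forall_noNearChain hRf hRa g hYN hYN hν hνΦ
    (fun s _ Z hZ hZν hne => answers_of_resolutions hRtot (resolutions_of_noNearChains hRf hRa hRtot hq' N) g hYN
      hνΦ hYN' s Z hZ hZν hne)
    (fun y hy hycl => hq' N ν Y y ⟨⟨k, ‹_›, ‹_›, g, ‹_›, ‹_›, ‹_›⟩, ‹_›, hYN, hν, hycl, hy⟩)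

end CampaignW42

end Summit.ResolutionOfSingularities.ResolutionOfSingularities.Theorems

end
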